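import Summits.CriticalPhenomena.PercolationContinuityZ3.Theorems.PercNearOneGluingNoHeavyLowerTailIncStarKeyChord
import Summits.CriticalPhenomena.PercolationContinuityZ3.Theorems.PercNearOneGluingNoHeavyLowerTailCILScaledReferenceTools
import HarnessLib

/-!
# The increasing star from BERNSTEIN-positivity of the root–unmarked KEY along the other root edges

Support file for the Sahi programme (`--supports stmt-CriticalPhenomena-4575`, prover prim-sahi-p2 gen 6).  No definitions, no named facts,
no sorries; standard axioms.  Memo: `run/shared/lean/prim/prim-sahi/FROM-prim-sahi-p2-gen6-KEY-FIBRE-CHORD.md` (§9), `prim-sahi-p2/PROOF-E3.md` §17.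

Sequel of `…IncStarKeyChord`.  There the increasing star was reduced to CHORD-concavity of `a = w f ↦ K'(w[f↦a])` along root-component pairs
`f`; that hypothesis turned out to fail on some simple weighted graphs with `n ≥ 6` (ttrl2 cp-kc, near-certain root–hub bypass, margin `−1.2e−8`),
exactly as the chord of `E₃` itself fails.  What the census supports instead (and what three-copy FIBRE-positivity of `K' = 3F₂ − 2F₃`, verified on
every graph with at most six vertices, implies coefficientwise) is the weaker BERNSTEIN form: the cubic `a ↦ K'(w[f↦a])` has nonnegative
middle Bernstein coefficients `C₁, C₂`.  Since a cubic is determined by its values at `0, ⅓, ⅔, 1`,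
`18·C₁ = −15·K'(0) + 54·K'(⅓) − 27·K'(⅔) + 6·K'(1)` and `18·C₂ = 6·K'(0) − 27·K'(⅓) + 54·K'(⅔) − 15·K'(1)`,
so the hypothesis is stated with `key` at four weights only (no new definition).

* `real_update_update_affine` — `P_{w[f↦t][e↦y]}(S) = (1−t)·P_{w[f↦0][e↦y]}(S) + t·P_{w[f↦1][e↦y]}(S)` (from `HullPort.real_update_affine`);
* `rootKey_bernstein_expansion` — the exact expansion `K'(w) = (1−a)³K'(w[f↦0]) + 3a(1−a)²C₁ + 3a²(1−a)C₂ + a³K'(w[f↦1])`, `a = w f`, `f ≠ s(s,z)`;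
* `rootKey_nonneg_of_bernstein`, **`incStar_nonneg_of_rootKeyBernstein`** — the induction of `…IncStarKeyChord` with the chord step replaced by the
  Bernstein step: the increasing star on every finite weighted graph on `Fin n` follows from `C₁, C₂ ≥ 0` along every fractional root-component
  pair `f ≠ s(s,z)` (given the star for all weights with fewer fractional non-loop pairs).  Base case unchanged (`rootKey_nonneg_of_closedComponent`).
-/

noncomputable section

namespace Summit.CriticalPhenomena.PercolationContinuityZ3.Theorems

namespace IncStar

open MeasureTheory Literature.Probability.Percolation Literature.Probability.LatticeModels EdgeInduction TerminalEdgeInduction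
open scoped Classical

variable {n : ℕ}

/-- The constant `⅓` of the unit interval. -/
private theorem third_mem : (1 / 3 : ℝ) ∈ unitInterval := ⟨by norm_num, by norm_num⟩
/-- The constant `⅔` of the unit interval. -/
private theorem twoThirds_mem : (2 / 3 : ℝ) ∈ unitInterval := ⟨by norm_num, by norm_num⟩

/-- One-bond decomposition at `f` behind a further update at a different pair `e`:
`P_{w[f↦t][e↦y]}(S) = (1 − t)·P_{w[f↦0][e↦y]}(S) + t·P_{w[f↦1][e↦y]}(S)`. [folklore] -/
theorem real_update_update_affine (w : Sym2 (Fin n) → unitInterval) {e f : Sym2 (Fin n)} (hfe : f ≠ e) (t y : unitInterval)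
    (S : Set (BondConfig (Fin n))) :
    (prodBernoulli (Function.update (Function.update w f t) e y)).real S =
      (1 - (t : ℝ)) * (prodBernoulli (Function.update (Function.update w f 0) e y)).real S
        + (t : ℝ) * (prodBernoulli (Function.update (Function.update w f 1) e y)).real S := by
  rw [Function.update_comm hfe t y w, Function.update_comm hfe 0 y w, Function.update_comm hfe 1 y w]
  exact HullPort.real_update_affine (Function.update w e y) f t S

/-- **Bernstein expansion of the root–unmarked KEY along another pair.**  For `f ≠ e = s(s,z)` and `a = w f`, writing `K(t) = key P_{w[f↦t][e↦1]} P_{w[f↦t][e↦0]}`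
of `({s↔b},{s↔c},{s↔y})`:  `18·K(a)·` … precisely
`18·key P_{w[e↦1]} P_{w[e↦0]} = 18(1−a)³K(0) + 3a(1−a)²·(−15K(0) + 54K(⅓) − 27K(⅔) + 6K(1)) + 3a²(1−a)·(6K(0) − 27K(⅓) + 54K(⅔) − 15K(1)) + 18a³K(1)`
(the cubic `t ↦ K(t)` through its values at `0, ⅓, ⅔, 1`). [this work] -/
theorem rootKey_bernstein_expansion (w : Sym2 (Fin n) → unitInterval) (s b c y z : Fin n) {f : Sym2 (Fin n)} (hfe : f ≠ s(s, z)) :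
    18 * key (prodBernoulli (Function.update w s(s, z) 1)) (prodBernoulli (Function.update w s(s, z) 0)) (openConn s b) (openConn s c) (openConn s y) =
      18 * (1 - (w f : ℝ)) ^ 3 *
          key (prodBernoulli (Function.update (Function.update w f 0) s(s, z) 1)) (prodBernoulli (Function.update (Function.update w f 0) s(s, z) 0))
            (openConn s b) (openConn s c) (openConn s y)
      + 3 * (w f : ℝ) * (1 - (w f : ℝ)) ^ 2 *
          (-15 * key (prodBernoulli (Function.update (Function.update w f 0) s(s, z) 1)) (prodBernoulli (Function.update (Function.update w f 0) s(s, z) 0))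
                  (openConn s b) (openConn s c) (openConn s y)
            + 54 * key (prodBernoulli (Function.update (Function.update w f ⟨1 / 3, third_mem⟩) s(s, z) 1))
                  (prodBernoulli (Function.update (Function.update w f ⟨1 / 3, third_mem⟩) s(s, z) 0)) (openConn s b) (openConn s c) (openConn s y)
            - 27 * key (prodBernoulli (Function.update (Function.update w f ⟨2 / 3, twoThirds_mem⟩) s(s, z) 1))
                  (prodBernoulli (Function.update (Function.update w f ⟨2 / 3, twoThirds_mem⟩) s(s, z) 0)) (openConn s b) (openConn s c) (openConn s y)
            + 6 * key (prodBernoulli (Function.update (Function.update w f 1) s(s, z) 1)) (prodBernoulli (Function.update (Function.update w f 1) s(s, z) 0))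
                  (openConn s b) (openConn s c) (openConn s y))
      + 3 * (w f : ℝ) ^ 2 * (1 - (w f : ℝ)) *
          (6 * key (prodBernoulli (Function.update (Function.update w f 0) s(s, z) 1)) (prodBernoulli (Function.update (Function.update w f 0) s(s, z) 0))
                  (openConn s b) (openConn s c) (openConn s y)
            - 27 * key (prodBernoulli (Function.update (Function.update w f ⟨1 / 3, third_mem⟩) s(s, z) 1))
                  (prodBernoulli (Function.update (Function.update w f ⟨1 / 3, third_mem⟩) s(s, z) 0)) (openConn s b) (openConn s c) (openConn s y)
            + 54 * key (prodBernoulli (Function.update (Function.update w f ⟨2 / 3, twoThirds_mem⟩) s(s, z) 1))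
                  (prodBernoulli (Function.update (Function.update w f ⟨2 / 3, twoThirds_mem⟩) s(s, z) 0)) (openConn s b) (openConn s c) (openConn s y)
            - 15 * key (prodBernoulli (Function.update (Function.update w f 1) s(s, z) 1)) (prodBernoulli (Function.update (Function.update w f 1) s(s, z) 0))
                  (openConn s b) (openConn s c) (openConn s y))
      + 18 * (w f : ℝ) ^ 3 *
          key (prodBernoulli (Function.update (Function.update w f 1) s(s, z) 1)) (prodBernoulli (Function.update (Function.update w f 1) s(s, z) 0))
            (openConn s b) (openConn s c) (openConn s y) := by
  set e : Sym2 (Fin n) := s(s, z) with he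
  -- write `w = w[f ↦ w f]` on the left so that every law is `P_{w[f↦t][e↦y]}` and decomposes affinely in `t`
  have hw : w = Function.update w f (w f) := (Function.update_eq_self f w).symm
  have hA := real_update_update_affine w hfe (w f)
  have hB := real_update_update_affine w hfe ⟨1 / 3, third_mem⟩
  have hC := real_update_update_affine w hfe ⟨2 / 3, twoThirds_mem⟩
  conv_lhs => rw [hw]
  simp only [key_eq, hA, hB, hC]
  ring

/-- **`K' ≥ 0` from Bernstein-positivity along the other root-component pairs.**  If for every weight, marking and fractional non-loop pair
`f = s(u,v) ≠ e = s(s,z)` with `u` in the weight-1 component of `s`, the two middle Bernstein coefficients of `a = w f ↦ K'(w[f↦a])` are nonnegative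
(stated through the values at `0, ⅓, ⅔, 1`; the star being available for all weights with fewer fractional non-loop pairs), then `K'(w) ≥ 0` for
every weight carrying that induction hypothesis. [this work] -/
theorem rootKey_nonneg_of_bernstein
    (hKB : ∀ (w : Sym2 (Fin n) → unitInterval) (s b c y z u v : Fin n), z ≠ s → z ≠ b → z ≠ c → z ≠ y →
      u ≠ v → s(u, v) ≠ s(s, z) → s(u, v) ∈ fracEdges w →
      (SimpleGraph.fromEdgeSet {f : Sym2 (Fin n) | Function.update w s(s, z) 0 f = 1}).Reachable s u →
      (∀ w' : Sym2 (Fin n) → unitInterval,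
          ((fracEdges w').filter fun f => ¬ f.IsDiag).card < ((fracEdges w).filter fun f => ¬ f.IsDiag).card →
          ∀ s' b' c' y' : Fin n, 0 ≤ sahiE3 (prodBernoulli w') (openConn s' b') (openConn s' c') (openConn s' y')) →
      0 ≤ -15 * key (prodBernoulli (Function.update (Function.update w s(u, v) 0) s(s, z) 1))
                  (prodBernoulli (Function.update (Function.update w s(u, v) 0) s(s, z) 0)) (openConn s b) (openConn s c) (openConn s y)
          + 54 * key (prodBernoulli (Function.update (Function.update w s(u, v) ⟨1 / 3, third_mem⟩) s(s, z) 1))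
                  (prodBernoulli (Function.update (Function.update w s(u, v) ⟨1 / 3, third_mem⟩) s(s, z) 0)) (openConn s b) (openConn s c) (openConn s y)
          - 27 * key (prodBernoulli (Function.update (Function.update w s(u, v) ⟨2 / 3, twoThirds_mem⟩) s(s, z) 1))
                  (prodBernoulli (Function.update (Function.update w s(u, v) ⟨2 / 3, twoThirds_mem⟩) s(s, z) 0)) (openConn s b) (openConn s c) (openConn s y)
          + 6 * key (prodBernoulli (Function.update (Function.update w s(u, v) 1) s(s, z) 1))
                  (prodBernoulli (Function.update (Function.update w s(u, v) 1) s(s, z) 0)) (openConn s b) (openConn s c) (openConn s y) ∧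
      0 ≤ 6 * key (prodBernoulli (Function.update (Function.update w s(u, v) 0) s(s, z) 1))
                  (prodBernoulli (Function.update (Function.update w s(u, v) 0) s(s, z) 0)) (openConn s b) (openConn s c) (openConn s y)
          - 27 * key (prodBernoulli (Function.update (Function.update w s(u, v) ⟨1 / 3, third_mem⟩) s(s, z) 1))
                  (prodBernoulli (Function.update (Function.update w s(u, v) ⟨1 / 3, third_mem⟩) s(s, z) 0)) (openConn s b) (openConn s c) (openConn s y)
          + 54 * key (prodBernoulli (Function.update (Function.update w s(u, v) ⟨2 / 3, twoThirds_mem⟩) s(s, z) 1))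
                  (prodBernoulli (Function.update (Function.update w s(u, v) ⟨2 / 3, twoThirds_mem⟩) s(s, z) 0)) (openConn s b) (openConn s c) (openConn s y)
          - 15 * key (prodBernoulli (Function.update (Function.update w s(u, v) 1) s(s, z) 1))
                  (prodBernoulli (Function.update (Function.update w s(u, v) 1) s(s, z) 0)) (openConn s b) (openConn s c) (openConn s y)) :
    ∀ (k : ℕ) (w : Sym2 (Fin n) → unitInterval) (s b c y z : Fin n), z ≠ s → z ≠ b → z ≠ c → z ≠ y →
      ((fracEdges w).filter fun g => ¬ g.IsDiag ∧ g ≠ s(s, z)).card ≤ k →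
      (∀ w' : Sym2 (Fin n) → unitInterval,
          ((fracEdges w').filter fun f => ¬ f.IsDiag).card < ((fracEdges w).filter fun f => ¬ f.IsDiag).card →
          ∀ s' b' c' y' : Fin n, 0 ≤ sahiE3 (prodBernoulli w') (openConn s' b') (openConn s' c') (openConn s' y')) →
      0 ≤ key (prodBernoulli (Function.update w s(s, z) 1)) (prodBernoulli (Function.update w s(s, z) 0))
            (openConn s b) (openConn s c) (openConn s y) := by
  intro k
  induction k with
  | zero =>
      intro w s b c y z _ _ _ _ hk _
      refine rootKey_nonneg_of_closedComponent w s b c y z fun u v _ huv hfe hmem => ?_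
      have : s(u, v) ∈ (fracEdges w).filter fun g => ¬ g.IsDiag ∧ g ≠ s(s, z) :=
        Finset.mem_filter.2 ⟨hmem, by rwa [Sym2.mk_isDiag_iff], hfe⟩
      have := Finset.card_pos.2 ⟨_, this⟩
      omega
  | succ k ih =>
      intro w s b c y z hzs hzb hzc hzy hk IH
      by_cases hex : ∃ u v : Fin n, (SimpleGraph.fromEdgeSet {f : Sym2 (Fin n) | Function.update w s(s, z) 0 f = 1}).Reachable s u ∧
          u ≠ v ∧ s(u, v) ≠ s(s, z) ∧ s(u, v) ∈ fracEdges w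
      · obtain ⟨u, v, hu, huv, hfe, hmem⟩ := hex
        set f : Sym2 (Fin n) := s(u, v) with hfdef
        have hnd : ¬ f.IsDiag := by rw [hfdef, Sym2.mk_isDiag_iff]; exact huv
        obtain ⟨hC1, hC2⟩ := hKB w s b c y z u v hzs hzb hzc hzy huv hfe hmem hu IH
        have hk0 : ((fracEdges (Function.update w f 0)).filter fun g => ¬ g.IsDiag ∧ g ≠ s(s, z)).card ≤ k := by
          have := card_fracEdges_ne_update_lt w hmem hnd hfe 0 (Or.inl rfl); omega
        have hk1 : ((fracEdges (Function.update w f 1)).filter fun g => ¬ g.IsDiag ∧ g ≠ s(s, z)).card ≤ k := by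
          have := card_fracEdges_ne_update_lt w hmem hnd hfe 1 (Or.inr rfl); omega
        have IH0 : ∀ w' : Sym2 (Fin n) → unitInterval,
            ((fracEdges w').filter fun f => ¬ f.IsDiag).card < ((fracEdges (Function.update w f 0)).filter fun f => ¬ f.IsDiag).card →
            ∀ s' b' c' y' : Fin n, 0 ≤ sahiE3 (prodBernoulli w') (openConn s' b') (openConn s' c') (openConn s' y') :=
          fun w' hw' => IH w' (lt_of_lt_of_le hw' (card_fracEdges_update_le w f 0 (Or.inl rfl)))
        have IH1 : ∀ w' : Sym2 (Fin n) → unitInterval,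
            ((fracEdges w').filter fun f => ¬ f.IsDiag).card < ((fracEdges (Function.update w f 1)).filter fun f => ¬ f.IsDiag).card →
            ∀ s' b' c' y' : Fin n, 0 ≤ sahiE3 (prodBernoulli w') (openConn s' b') (openConn s' c') (openConn s' y') :=
          fun w' hw' => IH w' (lt_of_lt_of_le hw' (card_fracEdges_update_le w f 1 (Or.inr rfl)))
        have h0 := ih (Function.update w f 0) s b c y z hzs hzb hzc hzy hk0 IH0
        have h1 := ih (Function.update w f 1) s b c y z hzs hzb hzc hzy hk1 IH1
        have hexp := rootKey_bernstein_expansion w s b c y z hfe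
        have ha0 : (0 : ℝ) ≤ w f := (w f).2.1
        have ha1 : (w f : ℝ) ≤ 1 := (w f).2.2
        have hq : (0 : ℝ) ≤ 1 - w f := sub_nonneg.2 ha1
        have t0 : 0 ≤ 18 * (1 - (w f : ℝ)) ^ 3 *
            key (prodBernoulli (Function.update (Function.update w f 0) s(s, z) 1)) (prodBernoulli (Function.update (Function.update w f 0) s(s, z) 0))
              (openConn s b) (openConn s c) (openConn s y) := by positivity
        have t3 : 0 ≤ 18 * (w f : ℝ) ^ 3 *
            key (prodBernoulli (Function.update (Function.update w f 1) s(s, z) 1)) (prodBernoulli (Function.update (Function.update w f 1) s(s, z) 0))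
              (openConn s b) (openConn s c) (openConn s y) := by positivity
        have t1 := mul_nonneg (mul_nonneg (mul_nonneg (by norm_num : (0:ℝ) ≤ 3) ha0) (pow_nonneg hq 2)) hC1
        have t2 := mul_nonneg (mul_nonneg (mul_nonneg (by norm_num : (0:ℝ) ≤ 3) (pow_nonneg ha0 2)) hq) hC2
        nlinarith [hexp, t0, t1, t2, t3]
      · push Not at hex
        exact rootKey_nonneg_of_closedComponent w s b c y z fun u v hu huv hfe hmem => hex u v hu huv hfe hmem

/-- **The increasing star from BERNSTEIN-positivity of the root–unmarked KEY along the other root-component pairs.**  If for every weight `w`,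
all markings `s b c y`, every `z ∉ {s,b,c,y}` and every fractional non-loop pair `f = s(u,v) ≠ s(s,z)` with `u` joined to `s` by weight-`1` pairs
(with `s(s,z)` closed), the cubic `a ↦ K'(w[f↦a])` (`K' = key P_{·[sz↦1]} P_{·[sz↦0]}` of `({s↔b},{s↔c},{s↔y})`) has nonnegative middle
Bernstein coefficients — equivalently `−15K'(0) + 54K'(⅓) − 27K'(⅔) + 6K'(1) ≥ 0` and `6K'(0) − 27K'(⅓) + 54K'(⅔) − 15K'(1) ≥ 0` — granted the
increasing star for every weight with fewer fractional non-loop pairs and every marking, then `E₃({s↔b},{s↔c},{s↔y}) ≥ 0` on every finite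
weighted graph on `Fin n`.  (The hypothesis is implied coefficientwise by three-copy fibre-positivity of `K'`.) [this work] -/
theorem incStar_nonneg_of_rootKeyBernstein
    (hKB : ∀ (w : Sym2 (Fin n) → unitInterval) (s b c y z u v : Fin n), z ≠ s → z ≠ b → z ≠ c → z ≠ y →
      u ≠ v → s(u, v) ≠ s(s, z) → s(u, v) ∈ fracEdges w →
      (SimpleGraph.fromEdgeSet {f : Sym2 (Fin n) | Function.update w s(s, z) 0 f = 1}).Reachable s u →
      (∀ w' : Sym2 (Fin n) → unitInterval,
          ((fracEdges w').filter fun f => ¬ f.IsDiag).card < ((fracEdges w).filter fun f => ¬ f.IsDiag).card →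
          ∀ s' b' c' y' : Fin n, 0 ≤ sahiE3 (prodBernoulli w') (openConn s' b') (openConn s' c') (openConn s' y')) →
      0 ≤ -15 * key (prodBernoulli (Function.update (Function.update w s(u, v) 0) s(s, z) 1))
                  (prodBernoulli (Function.update (Function.update w s(u, v) 0) s(s, z) 0)) (openConn s b) (openConn s c) (openConn s y)
          + 54 * key (prodBernoulli (Function.update (Function.update w s(u, v) ⟨1 / 3, third_mem⟩) s(s, z) 1))
                  (prodBernoulli (Function.update (Function.update w s(u, v) ⟨1 / 3, third_mem⟩) s(s, z) 0)) (openConn s b) (openConn s c) (openConn s y)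
          - 27 * key (prodBernoulli (Function.update (Function.update w s(u, v) ⟨2 / 3, twoThirds_mem⟩) s(s, z) 1))
                  (prodBernoulli (Function.update (Function.update w s(u, v) ⟨2 / 3, twoThirds_mem⟩) s(s, z) 0)) (openConn s b) (openConn s c) (openConn s y)
          + 6 * key (prodBernoulli (Function.update (Function.update w s(u, v) 1) s(s, z) 1))
                  (prodBernoulli (Function.update (Function.update w s(u, v) 1) s(s, z) 0)) (openConn s b) (openConn s c) (openConn s y) ∧
      0 ≤ 6 * key (prodBernoulli (Function.update (Function.update w s(u, v) 0) s(s, z) 1))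
                  (prodBernoulli (Function.update (Function.update w s(u, v) 0) s(s, z) 0)) (openConn s b) (openConn s c) (openConn s y)
          - 27 * key (prodBernoulli (Function.update (Function.update w s(u, v) ⟨1 / 3, third_mem⟩) s(s, z) 1))
                  (prodBernoulli (Function.update (Function.update w s(u, v) ⟨1 / 3, third_mem⟩) s(s, z) 0)) (openConn s b) (openConn s c) (openConn s y)
          + 54 * key (prodBernoulli (Function.update (Function.update w s(u, v) ⟨2 / 3, twoThirds_mem⟩) s(s, z) 1))
                  (prodBernoulli (Function.update (Function.update w s(u, v) ⟨2 / 3, twoThirds_mem⟩) s(s, z) 0)) (openConn s b) (openConn s c) (openConn s y)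
          - 15 * key (prodBernoulli (Function.update (Function.update w s(u, v) 1) s(s, z) 1))
                  (prodBernoulli (Function.update (Function.update w s(u, v) 1) s(s, z) 0)) (openConn s b) (openConn s c) (openConn s y)) :
    ∀ (w : Sym2 (Fin n) → unitInterval) (s b c y : Fin n),
      0 ≤ sahiE3 (prodBernoulli w) (openConn s b) (openConn s c) (openConn s y) := by
  refine incStar_nonneg_of_rootUnmarkedBernsteinStrongIH ?_
  intro w s b c y z hzs hzb hzc hzy he IH
  have hnd : ¬ (s(s, z) : Sym2 (Fin n)).IsDiag := by rw [Sym2.mk_isDiag_iff]; exact hzs.symm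
  have h0 : 0 ≤ sahiE3 (prodBernoulli (Function.update w s(s, z) 0)) (openConn s b) (openConn s c) (openConn s y) :=
    IH _ (card_fracEdges_update_lt w he hnd 0 (Or.inl rfl)) s b c y
  have h1 : 0 ≤ sahiE3 (prodBernoulli (Function.update w s(s, z) 1)) (openConn s b) (openConn s c) (openConn s y) :=
    IH _ (card_fracEdges_update_lt w he hnd 1 (Or.inr rfl)) s b c y
  have hk := rootKey_nonneg_of_bernstein hKB _ w s b c y z hzs hzb hzc hzy le_rfl IH
  exact ⟨polar₁_nonneg_of_key_open h0 h1 hk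
      (pivotal_prod_nonneg_upper w s(s, z) (isUpperSet_openConn s b) (isUpperSet_openConn s c) (isUpperSet_openConn s y)),
    polar₁_swap_nonneg_of_key_open h1 hk⟩

end IncStar

end Summit.CriticalPhenomena.PercolationContinuityZ3.Theorems
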